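import Summits.ValiantsHypothesis.ValiantsHypothesis.Theorems.BarrierLeverChowHitsPartitionMinorsRFacePrivateThin

/-!
# Route BarrierLever — item `ChowHitsPartitionMinorsR` (stmt-ValiantsHypothesis-21882):
# padding, the x-star certificate as a predicate, and the residual nodes
# «thick pairs that are neither x-star- nor y-star-certifiable» (Theorems-side texts; glue in the companion file)

Helper file (`--supports stmt-ValiantsHypothesis-21882`; cell valiant-natproofs, rung V4, 𝒟-side
support item of route BarrierLever; prover seat val-np-p5 gen 30; planner RULING R47, STATUS l.1829).
Closes NO item.

WHY. The planner's line registry v1 for item 21882 (`Cruxes/ChowHitsPartitionMinorsR/Lines/affine_lower`)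
has two registered one-stub nodes: `stub_thickPairsChowR` (the item verbatim restricted to THICK layouts,
`h·h < ‖u‖ + h` and `h·h < ‖w‖ + h`, the complement of arrow G1 `ChowFacePrivate.chowHits_of_thin`) and
`stub_thickLowerSetsChowR` (lower-set pairs at budget `m + 2h ≤ h·h` restricted to `h·h < ‖v‖ + 2h`,
`h·h < ‖w'‖ + 2h`, the complement of G2 `ChowFacePrivate.exists_chow_of_thinLowerSets`). The x-star arrow
`ChowXStar.chowHits_of_xstarMatrix` (p714438) hits every layout whose XS-matrix
`[coeff_{y^{w j}} ∏_{a ∉ u i} (1 + Σ_c β_{a c} y_c)]_{i,j}` is nonsingular for some `β`, with `h` forms; by the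
`x ↔ y` flip the same holds when the XS-matrix of the swapped layout `(w, u)` is nonsingular («y-star»).
RULING R47 narrows both nodes by «not x-star-certifiable and not y-star-certifiable» as soon as the padding
arrow «hit by `h` forms ⇒ hit by every `M ≥ h` forms» is in the kernel by name. This file provides:

* `chowHits_mono` — PADDING ARROW: hit by `m` affine forms and `m ≤ M` ⇒ hit by `M` affine forms
  (constant factors `1`; `ChowLowerSets.exists_chow_fin_of_le`);
* `IsXStarCertifiable u w` — the predicate «some `β` makes the XS-matrix of `(u, w)` nonsingular»
  (the hypothesis of `ChowXStar.chowHits_of_xstarMatrix` VERBATIM, over `ℂ`);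
* node texts `Stmt.stub_thickPairsChowR`, `Stmt.stub_thickLowerSetsChowR` (registry v1 VERBATIM, restated
  Theorems-side for by-name credit) and the NARROWED texts `Stmt.stub_thickPairsChowRNoStar`,
  `Stmt.stub_thickLowerSetsChowRNoStar` (= the v1 texts + `¬ IsXStarCertifiable u w` + `¬ IsXStarCertifiable w u`);
* the compositions BY NAME `chowHitsPartitionMinorsR_of_thickPairs` (G1) and
  `chowHitsPartitionMinorsR_of_thickLowerSets` (G2 + p704381): each v1 node alone implies
  `Theses.BarrierLever.ChowHitsPartitionMinorsR`. The UNCONDITIONAL glue «narrowed node ⟹ v1 node» (x-star arrow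
  `ChowXStar.chowHits_of_xstarMatrix` + flip + padding) is the companion file `…ChowHitsPartitionMinorsRNoStarGlue`
  (it needs the module `…ChowHitsPartitionMinorsRXStar`).

MEMBERS OF THE NARROWED CLASS (seat memo MEMO-21882-valnp5-g29.md §10–§11, exhaustive census h = 5): a lower pair
is x-star-certifiable only if its tail profile is dominated (`#{S ∈ R : |S| ≥ d} ≤ #{W ∈ C : |W| ≥ d}` for all
`d`); at h = 5 every equal-size lower pair is x- or y-star-certifiable except the 150 ordered pairs
{singletons + star K₁,₄} vs {singletons + 4-cycle} (G2-thin) and the 2 000 thick ordered pairs with CROSSING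
tail profiles, all of which are hit by 5 generic forms. WHY THE NODE MIGHT FAIL: a thick crossing-profile lower
pair on which every product of `h·h − 2h` affine forms has vanishing partition minor.

WHAT THIS IS NOT: item 21882 is NOT proved; nothing on crux stmt-ValiantsHypothesis-14610 or on `VP` versus `VNP`.
-/

set_option linter.dupNamespace false

namespace Summit.ValiantsHypothesis.ValiantsHypothesis.Theorems.BarrierLever.ChowNoStar

open Finset MvPolynomial
open Summit.ValiantsHypothesis.ValiantsHypothesis.Theorems.BarrierLever.ChowLowerSets
  (exists_chow_fin_of_le chowHitsPartitionMinorsR_of_lowerSets)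
open Summit.ValiantsHypothesis.ValiantsHypothesis.Theorems.BarrierLever.ChowFacePrivate
  (chow_hit_swap_fin chowHits_of_thin exists_chow_of_thinLowerSets)

noncomputable section

variable {h r : ℕ}

/-! ## 1. Padding -/

/-- **PADDING ARROW.** If the layout `(u, w)` is hit by a product of `m` affine forms and `m ≤ M`, it is hit by
a product of exactly `M` affine forms (pad with constant factors `1`). -/
theorem chowHits_mono {m M : ℕ} (hmM : m ≤ M) (u w : Fin r → Finset (Fin h))
    (hhit : ∃ ℓ : Fin m → MvPolynomial (Fin (h + h)) ℂ, (∀ k, (ℓ k).totalDegree ≤ 1) ∧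
      (Matrix.of fun i j : Fin r => MvPolynomial.coeff (∑ a ∈ u i, Finsupp.single (Fin.castAdd h a) 1 +
          ∑ c ∈ w j, Finsupp.single (Fin.natAdd h c) 1) (∏ k, ℓ k)).det ≠ 0) :
    ∃ ℓ : Fin M → MvPolynomial (Fin (h + h)) ℂ, (∀ k, (ℓ k).totalDegree ≤ 1) ∧
      (Matrix.of fun i j : Fin r => MvPolynomial.coeff (∑ a ∈ u i, Finsupp.single (Fin.castAdd h a) 1 +
          ∑ c ∈ w j, Finsupp.single (Fin.natAdd h c) 1) (∏ k, ℓ k)).det ≠ 0 := by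
  obtain ⟨ℓ, hℓ, hdet⟩ := hhit
  obtain ⟨ℓ', hℓ', hprod⟩ := exists_chow_fin_of_le hmM ℓ hℓ
  exact ⟨ℓ', hℓ', by rw [hprod]; exact hdet⟩

/-! ## 2. The x-star certificate as a predicate -/

/-- **`IsXStarCertifiable u w`: the layout `(u, w)` is x-STAR-CERTIFIABLE** — for some coefficient table
`β : Fin h → Fin h → ℂ` the XS-matrix `[coeff_{y^{w j}} ∏_{a ∉ u i} (1 + Σ_c β_{a c} y_c)]_{i,j}` is nonsingular
(the hypothesis of `ChowXStar.chowHits_of_xstarMatrix`, p714438, VERBATIM over `ℂ`). The swapped predicate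
`IsXStarCertifiable w u` is «y-star-certifiable». -/
def IsXStarCertifiable (u w : Fin r → Finset (Fin h)) : Prop :=
  ∃ β : Fin h → Fin h → ℂ, (Matrix.of fun i j : Fin r =>
      coeff (∑ a ∈ (∅ : Finset (Fin h)), Finsupp.single (Fin.castAdd h a) 1 +
          ∑ c ∈ w j, Finsupp.single (Fin.natAdd h c) 1)
        (∏ a ∈ Finset.univ \ u i, (C (1 : ℂ) + ∑ a, C (0 : ℂ) * X (Fin.castAdd h a) +
            ∑ c, C (β a c) * X (Fin.natAdd h c)))).det ≠ 0

/-! ## 3. Node texts (registry v1 VERBATIM) and the narrowed texts -/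

/-- **NODE v1a (registry `affine_lower` v1, VERBATIM restatement Theorems-side): THICK PAIRS** — the item
restricted to layouts with both total sizes `‖u‖ = Σ_i |u i|`, `‖w‖` exceeding `h·h − h`. -/
def Stmt.stub_thickPairsChowR : Prop :=
  ∃ h₀ : ℕ, ∀ h : ℕ, h₀ ≤ h → ∀ (r : ℕ) (u w : Fin r → Finset (Fin h)),
    Function.Injective u → Function.Injective w →
    h * h < (∑ i, (u i).card) + h → h * h < (∑ j, (w j).card) + h →
    ∃ ℓ : Fin (h * h) → MvPolynomial (Fin (h + h)) ℂ,
      (∀ k, (ℓ k).totalDegree ≤ 1) ∧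
      (Matrix.of fun i j : Fin r => MvPolynomial.coeff
        (∑ a ∈ u i, Finsupp.single (Fin.castAdd h a) 1 +
          ∑ c ∈ w j, Finsupp.single (Fin.natAdd h c) 1) (∏ k, ℓ k)).det ≠ 0

/-- **NODE v1b (registry `affine_lower` v1, VERBATIM restatement Theorems-side): THICK LOWER-SET PAIRS at budget
`m + 2h ≤ h·h`** — lower-set pairs with both total sizes exceeding `h·h − 2h`. -/
def Stmt.stub_thickLowerSetsChowR : Prop :=
  ∃ h₀ : ℕ, ∀ h : ℕ, h₀ ≤ h → ∀ (r : ℕ) (v w' : Fin r → Finset (Fin h)),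
    Function.Injective v → Function.Injective w' →
    IsLowerSet (Set.range v) → IsLowerSet (Set.range w') →
    h * h < (∑ i, (v i).card) + 2 * h → h * h < (∑ j, (w' j).card) + 2 * h →
    ∃ m : ℕ, m + 2 * h ≤ h * h ∧ ∃ ℓ : Fin m → MvPolynomial (Fin (h + h)) ℂ,
      (∀ k, (ℓ k).totalDegree ≤ 1) ∧
      (Matrix.of fun i j : Fin r => MvPolynomial.coeff
        (∑ a ∈ v i, Finsupp.single (Fin.castAdd h a) 1 +
          ∑ c ∈ w' j, Finsupp.single (Fin.natAdd h c) 1) (∏ k, ℓ k)).det ≠ 0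

/-- **NARROWED NODE (R47): THICK PAIRS THAT ARE NEITHER x-STAR- NOR y-STAR-CERTIFIABLE** — `Stmt.stub_thickPairsChowR`
VERBATIM with the two further hypotheses `¬ IsXStarCertifiable u w` and `¬ IsXStarCertifiable w u`. WEAKER than
v1a, UNCONDITIONALLY (`ChowNoStar.stub_thickPairsChowR_of_noStar`, companion file). WHY IT MIGHT FAIL: a thick layout with crossing tail
profiles on which every product of `h·h` affine forms has vanishing partition minor. -/
def Stmt.stub_thickPairsChowRNoStar : Prop :=
  ∃ h₀ : ℕ, ∀ h : ℕ, h₀ ≤ h → ∀ (r : ℕ) (u w : Fin r → Finset (Fin h)),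
    Function.Injective u → Function.Injective w →
    h * h < (∑ i, (u i).card) + h → h * h < (∑ j, (w j).card) + h →
    ¬ IsXStarCertifiable u w → ¬ IsXStarCertifiable w u →
    ∃ ℓ : Fin (h * h) → MvPolynomial (Fin (h + h)) ℂ,
      (∀ k, (ℓ k).totalDegree ≤ 1) ∧
      (Matrix.of fun i j : Fin r => MvPolynomial.coeff
        (∑ a ∈ u i, Finsupp.single (Fin.castAdd h a) 1 +
          ∑ c ∈ w j, Finsupp.single (Fin.natAdd h c) 1) (∏ k, ℓ k)).det ≠ 0

/-- **NARROWED NODE (R47): THICK LOWER-SET PAIRS THAT ARE NEITHER x-STAR- NOR y-STAR-CERTIFIABLE** —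
`Stmt.stub_thickLowerSetsChowR` VERBATIM with the two further hypotheses `¬ IsXStarCertifiable v w'` and
`¬ IsXStarCertifiable w' v`. WEAKER than v1b, UNCONDITIONALLY (`ChowNoStar.stub_thickLowerSetsChowR_of_noStar`, companion file). At h = 5 its
members are exactly the 2 000 thick ordered lower pairs with crossing tail profiles (memo §11). WHY IT MIGHT FAIL:
a thick crossing-profile lower pair needing more than `h·h − 2h` forms. -/
def Stmt.stub_thickLowerSetsChowRNoStar : Prop :=
  ∃ h₀ : ℕ, ∀ h : ℕ, h₀ ≤ h → ∀ (r : ℕ) (v w' : Fin r → Finset (Fin h)),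
    Function.Injective v → Function.Injective w' →
    IsLowerSet (Set.range v) → IsLowerSet (Set.range w') →
    h * h < (∑ i, (v i).card) + 2 * h → h * h < (∑ j, (w' j).card) + 2 * h →
    ¬ IsXStarCertifiable v w' → ¬ IsXStarCertifiable w' v →
    ∃ m : ℕ, m + 2 * h ≤ h * h ∧ ∃ ℓ : Fin m → MvPolynomial (Fin (h + h)) ℂ,
      (∀ k, (ℓ k).totalDegree ≤ 1) ∧
      (Matrix.of fun i j : Fin r => MvPolynomial.coeff
        (∑ a ∈ v i, Finsupp.single (Fin.castAdd h a) 1 +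
          ∑ c ∈ w' j, Finsupp.single (Fin.natAdd h c) 1) (∏ k, ℓ k)).det ≠ 0

/-! ## 4. Compositions of the v1 nodes into the item, BY NAME -/

/-- **COMPOSITION (registry v1, kernel): the thick-pairs node v1a closes item 21882** — thin layouts by arrow G1
`ChowFacePrivate.chowHits_of_thin`, thick ones by the node. -/
theorem chowHitsPartitionMinorsR_of_thickPairs (hT : Stmt.stub_thickPairsChowR) :
    Summit.ValiantsHypothesis.ValiantsHypothesis.Theses.BarrierLever.ChowHitsPartitionMinorsR := by
  obtain ⟨h₀, hT⟩ := hT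
  refine ⟨h₀, fun h hh r u w hu hw => ?_⟩
  by_cases h1 : (∑ i, (u i).card) + h ≤ h * h ∨ (∑ j, (w j).card) + h ≤ h * h
  · exact chowHits_of_thin h r u w hu hw h1
  · push Not at h1
    exact hT h hh r u w hu hw (by omega) (by omega)

/-- **COMPOSITION (registry v1, kernel): the thick lower-set node v1b closes item 21882** — thin lower-set pairs by
arrow G2 `ChowFacePrivate.exists_chow_of_thinLowerSets`, thick ones by the node, then the lower-set reduction
`ChowLowerSets.chowHitsPartitionMinorsR_of_lowerSets` (p704381). -/
theorem chowHitsPartitionMinorsR_of_thickLowerSets (hT : Stmt.stub_thickLowerSetsChowR) :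
    Summit.ValiantsHypothesis.ValiantsHypothesis.Theses.BarrierLever.ChowHitsPartitionMinorsR := by
  obtain ⟨h₀, hT⟩ := hT
  refine chowHitsPartitionMinorsR_of_lowerSets h₀ fun h hh r v w' hv hw hlv hlw => ?_
  by_cases h1 : (∑ i, (v i).card) + 2 * h ≤ h * h ∨ (∑ j, (w' j).card) + 2 * h ≤ h * h
  · exact exists_chow_of_thinLowerSets h r v w' hv hw hlv hlw h1
  · push Not at h1
    exact hT h hh r v w' hv hw hlv hlw (by omega) (by omega)

/-- sanity (kernel): the item implies each node (the nodes are restrictions of the item; for the lower-set node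
take `m := h·h − 2h` by trivial padding is NOT available downward, so only the thick-pairs direction is recorded). -/
theorem stub_thickPairsChowRNoStar_of_item
    (H : Summit.ValiantsHypothesis.ValiantsHypothesis.Theses.BarrierLever.ChowHitsPartitionMinorsR) :
    Stmt.stub_thickPairsChowRNoStar := by
  obtain ⟨h₀, H⟩ := H
  exact ⟨h₀, fun h hh r u w hu hw _ _ _ _ => H h hh r u w hu hw⟩

end

end Summit.ValiantsHypothesis.ValiantsHypothesis.Theorems.BarrierLever.ChowNoStar
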